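import Literature.Analysis.PDE.QuasilinearExistence
import HarnessLib

/-!
# Short-time existence for quasilinear strictly parabolic systems on closed manifolds
# (topic `Analysis/PDE`)

The hypothesis `hQL` of `Literature.Geometry.Riemannian.ricciFlow_shortTime_existence_of_quasilinear`
in full generality: values in a finite-dimensional normed space (transported to a Euclidean space
by a linear isomorphism) and a model space of arbitrary finite dimension (the zero-dimensional
case being a finite family of smooth ODEs).

* `quasilinear_shortTime_existence_pos` — positive-dimensional model, any value space;
* `quasilinear_shortTime_existence_zero` — zero-dimensional model;
* `quasilinear_shortTime_existence` — the statement `hQL` verbatim.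

Everything is proved; no named fact and no `sorry` is introduced.

## References

* M. E. Taylor, *Partial Differential Equations III*, 2nd ed., Springer 2011, Ch. 15, §7.
  [TaylorPDEIII2011]
* C. Mantegazza, L. Martinazzi, *A note on quasilinear parabolic equations on manifolds*,
  Ann. Sc. Norm. Super. Pisa Cl. Sci. (5) 11 (2012), 857–874. [MantegazzaMartinazzi2012]
-/

noncomputable section

open Set Function Filter Topology Metric
open scoped Manifold ContDiff Topology

universe u v w

namespace Literature.Analysis.PDE

open Literature.Geometry.Manifold

/-! ### Transport of the value space to a Euclidean space -/

section Transport

variable {E : Type*} [NormedAddCommGroup E] [NormedSpace ℝ E] [FiniteDimensional ℝ E] {H : Type*} [TopologicalSpace H]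
variable {I : ModelWithCorners ℝ E H} {M : Type*} [TopologicalSpace M] [ChartedSpace H M]
variable {W : Type*} [NormedAddCommGroup W] [NormedSpace ℝ W] [FiniteDimensional ℝ W]
variable {ιb : Type*} [Fintype ιb]

set_option maxHeartbeats 1600000 in
/-- **Short-time existence, positive-dimensional model, arbitrary value space**: transport of
`quasilinear_shortTime_existence_core` along a linear isomorphism `W ≃L ℝ^d`.
[cite: TaylorPDEIII2011, Ch. 15, §7] -/
theorem quasilinear_shortTime_existence_pos [Nontrivial E] [I.Boundaryless] [T2Space M] [CompactSpace M] [IsManifold I ∞ M]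
    (b : Module.Basis ιb ℝ E) {𝒪 : Set (M × W)} (h𝒪 : IsOpen 𝒪) (P : (M → W) → M → W)
    (a : M → E × W × (E →L[ℝ] W) → ιb → ιb → ℝ) (f : M → E × W × (E →L[ℝ] W) → W)
    (ha : ∀ z i i', ContDiffOn ℝ ∞ (fun j ↦ a z j i i') {j | j.1 ∈ (extChartAt I z).target ∧ ((extChartAt I z).symm j.1, j.2.1) ∈ 𝒪})
    (hf : ∀ z, ContDiffOn ℝ ∞ (f z) {j | j.1 ∈ (extChartAt I z).target ∧ ((extChartAt I z).symm j.1, j.2.1) ∈ 𝒪})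
    (hstruct : ∀ z (j : E × W × (E →L[ℝ] W)), j.1 ∈ (extChartAt I z).target → ((extChartAt I z).symm j.1, j.2.1) ∈ 𝒪 →
      (∀ i i', a z j i i' = a z j i' i) ∧ ∀ ξ : ιb → ℝ, ξ ≠ 0 → 0 < ∑ i, ∑ i', a z j i i' * ξ i * ξ i')
    (hP : ∀ u : M → W, ContMDiff I 𝓘(ℝ, W) ∞ u → (∀ x, (x, u x) ∈ 𝒪) → ∀ z, ∀ y ∈ (extChartAt I z).target,
      P u ((extChartAt I z).symm y) =
        (∑ i, ∑ i', a z (y, u ((extChartAt I z).symm y), fderiv ℝ (u ∘ (extChartAt I z).symm) y) i i' •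
          fderiv ℝ (fderiv ℝ (u ∘ (extChartAt I z).symm)) y (b i) (b i')) +
        f z (y, u ((extChartAt I z).symm y), fderiv ℝ (u ∘ (extChartAt I z).symm) y))
    (u₀ : M → W) (hu₀ : ContMDiff I 𝓘(ℝ, W) ∞ u₀) (hg₀ : ∀ x, (x, u₀ x) ∈ 𝒪) :
    ∃ ε : ℝ, 0 < ε ∧ ∃ u : M → ℝ → W,
      ContMDiffOn (I.prod 𝓘(ℝ, ℝ)) 𝓘(ℝ, W) ∞ (fun p : M × ℝ ↦ u p.1 p.2) (univ ×ˢ Icc 0 ε) ∧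
      (∀ x, u x 0 = u₀ x) ∧ (∀ t ∈ Icc (0 : ℝ) ε, ∀ x, (x, u x t) ∈ 𝒪) ∧
      ∀ t ∈ Icc (0 : ℝ) ε, ∀ x, HasDerivWithinAt (u x) (P (fun x' ↦ u x' t) x) (Icc 0 ε) t := by
  set d : ℕ := Module.finrank ℝ W with hd
  set e : W ≃L[ℝ] EuclideanSpace ℝ (Fin d) := ContinuousLinearEquiv.ofFinrankEq (by simp [hd]) with he
  -- the transport of jets
  set τ : E × EuclideanSpace ℝ (Fin d) × (E →L[ℝ] EuclideanSpace ℝ (Fin d)) → E × W × (E →L[ℝ] W) :=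
    fun j ↦ (j.1, e.symm j.2.1, (e.symm : EuclideanSpace ℝ (Fin d) →L[ℝ] W).comp j.2.2) with hτ
  have hτs : ContDiff ℝ ∞ τ := by
    refine contDiff_fst.prodMk ((e.symm.contDiff.comp (contDiff_fst.comp contDiff_snd)).prodMk ?_)
    exact ((ContinuousLinearMap.compL ℝ E (EuclideanSpace ℝ (Fin d)) W) (e.symm : EuclideanSpace ℝ (Fin d) →L[ℝ] W)).contDiff.comp
      (contDiff_snd.comp contDiff_snd)
  set 𝒪' : Set (M × EuclideanSpace ℝ (Fin d)) := {p | (p.1, e.symm p.2) ∈ 𝒪} with h𝒪'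
  have h𝒪'o : IsOpen 𝒪' := h𝒪.preimage (continuous_fst.prodMk (e.symm.continuous.comp continuous_snd))
  have hdom : ∀ z (j : E × EuclideanSpace ℝ (Fin d) × (E →L[ℝ] EuclideanSpace ℝ (Fin d))),
      j ∈ {j | j.1 ∈ (extChartAt I z).target ∧ ((extChartAt I z).symm j.1, j.2.1) ∈ 𝒪'} →
      τ j ∈ {j : E × W × (E →L[ℝ] W) | j.1 ∈ (extChartAt I z).target ∧ ((extChartAt I z).symm j.1, j.2.1) ∈ 𝒪} := fun z j hj ↦ hj
  set P' : (M → EuclideanSpace ℝ (Fin d)) → M → EuclideanSpace ℝ (Fin d) := fun u' x ↦ e (P (fun x ↦ e.symm (u' x)) x) with hP'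
  set a' : M → E × EuclideanSpace ℝ (Fin d) × (E →L[ℝ] EuclideanSpace ℝ (Fin d)) → ιb → ιb → ℝ := fun z j ↦ a z (τ j) with ha'
  set f' : M → E × EuclideanSpace ℝ (Fin d) × (E →L[ℝ] EuclideanSpace ℝ (Fin d)) → EuclideanSpace ℝ (Fin d) := fun z j ↦ e (f z (τ j)) with hf'
  have ha's : ∀ z i i', ContDiffOn ℝ ∞ (fun j ↦ a' z j i i') {j | j.1 ∈ (extChartAt I z).target ∧ ((extChartAt I z).symm j.1, j.2.1) ∈ 𝒪'} :=
    fun z i i' ↦ (ha z i i').comp hτs.contDiffOn (hdom z)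
  have hf's : ∀ z, ContDiffOn ℝ ∞ (f' z) {j | j.1 ∈ (extChartAt I z).target ∧ ((extChartAt I z).symm j.1, j.2.1) ∈ 𝒪'} :=
    fun z ↦ e.contDiff.comp_contDiffOn ((hf z).comp hτs.contDiffOn (hdom z))
  have hstruct' : ∀ z (j : E × EuclideanSpace ℝ (Fin d) × (E →L[ℝ] EuclideanSpace ℝ (Fin d))), j.1 ∈ (extChartAt I z).target →
      ((extChartAt I z).symm j.1, j.2.1) ∈ 𝒪' → (∀ i i', a' z j i i' = a' z j i' i) ∧ ∀ ξ : ιb → ℝ, ξ ≠ 0 → 0 < ∑ i, ∑ i', a' z j i i' * ξ i * ξ i' :=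
    fun z j h1 h2 ↦ hstruct z (τ j) h1 h2
  -- the chain rules along `e.symm`
  have key1 : ∀ (u' : M → EuclideanSpace ℝ (Fin d)) (z : M) (y : E),
      fderiv ℝ ((fun x ↦ e.symm (u' x)) ∘ (extChartAt I z).symm) y = (e.symm : EuclideanSpace ℝ (Fin d) →L[ℝ] W).comp (fderiv ℝ (u' ∘ (extChartAt I z).symm) y) := by
    intro u' z y
    exact e.symm.comp_fderiv (f := u' ∘ (extChartAt I z).symm)
  have key2 : ∀ (u' : M → EuclideanSpace ℝ (Fin d)) (z : M) (y : E) (v w : E),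
      fderiv ℝ (fderiv ℝ ((fun x ↦ e.symm (u' x)) ∘ (extChartAt I z).symm)) y v w = e.symm (fderiv ℝ (fderiv ℝ (u' ∘ (extChartAt I z).symm)) y v w) := by
    intro u' z y v w
    have h1 : fderiv ℝ ((fun x ↦ e.symm (u' x)) ∘ (extChartAt I z).symm) = fun y ↦ (e.symm : EuclideanSpace ℝ (Fin d) →L[ℝ] W).comp (fderiv ℝ (u' ∘ (extChartAt I z).symm) y) :=
      funext fun y ↦ key1 u' z y
    rw [h1, fderiv_continuousLinearEquiv_comp]
    rfl
  have hP's : ∀ u' : M → EuclideanSpace ℝ (Fin d), ContMDiff I 𝓘(ℝ, EuclideanSpace ℝ (Fin d)) ∞ u' → (∀ x, (x, u' x) ∈ 𝒪') →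
      ∀ z, ∀ y ∈ (extChartAt I z).target, P' u' ((extChartAt I z).symm y) =
        (∑ i, ∑ i', a' z (y, u' ((extChartAt I z).symm y), fderiv ℝ (u' ∘ (extChartAt I z).symm) y) i i' •
          fderiv ℝ (fderiv ℝ (u' ∘ (extChartAt I z).symm)) y (b i) (b i')) +
        f' z (y, u' ((extChartAt I z).symm y), fderiv ℝ (u' ∘ (extChartAt I z).symm) y) := by
    intro u' hu' hg' z y hy
    have hu : ContMDiff I 𝓘(ℝ, W) ∞ (fun x ↦ e.symm (u' x)) := e.symm.contDiff.comp_contMDiff hu'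
    have h := hP (fun x ↦ e.symm (u' x)) hu (fun x ↦ hg' x) z y hy
    simp only [hP', ha', hf', hτ, h, map_add, map_sum, map_smul, key1, key2, ContinuousLinearEquiv.apply_symm_apply]
  have hu₀' : ContMDiff I 𝓘(ℝ, EuclideanSpace ℝ (Fin d)) ∞ (fun x ↦ e (u₀ x)) := e.contDiff.comp_contMDiff hu₀
  have hg₀' : ∀ x, (x, e (u₀ x)) ∈ 𝒪' := fun x ↦ by simp [h𝒪', hg₀ x]
  obtain ⟨ε, hε, u', hsm, h0, hgr, hode⟩ := quasilinear_shortTime_existence_core (I := I) b h𝒪'o P' a' f' ha's hf's hstruct' hP's _ hu₀' hg₀'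
  refine ⟨ε, hε, fun x t ↦ e.symm (u' x t), fun p hp ↦ e.symm.contDiff.contDiffAt.comp_contMDiffWithinAt (hsm p hp), fun x ↦ by simp [h0 x],
    fun t ht x ↦ hgr t ht x, fun t ht x ↦ ?_⟩
  have h := (e.symm : EuclideanSpace ℝ (Fin d) →L[ℝ] W).hasFDerivAt.comp_hasDerivWithinAt t (hode t ht x)
  have h2 : (e.symm : EuclideanSpace ℝ (Fin d) →L[ℝ] W) (P' (fun x' ↦ u' x' t) x) = P (fun x' ↦ e.symm (u' x' t)) x := by simp [hP']
  rw [h2] at h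
  exact h

end Transport

/-! ### The zero-dimensional model: a finite family of smooth ODEs -/

section Zero

variable {E : Type*} [NormedAddCommGroup E] [NormedSpace ℝ E] [FiniteDimensional ℝ E] {H : Type*} [TopologicalSpace H]
variable {I : ModelWithCorners ℝ E H} {M : Type*} [TopologicalSpace M] [ChartedSpace H M]
variable {W : Type*} [NormedAddCommGroup W] [NormedSpace ℝ W] [FiniteDimensional ℝ W]
variable {ιb : Type*} [Fintype ιb]

set_option maxHeartbeats 1600000 in
/-- **Short-time existence, zero-dimensional model.** When `dim E = 0` the manifold is finite and
discrete, the representation of `P` reduces to `P u z = f_z(u z)`, and the system is a finite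
family of smooth autonomous ODEs, solved for a short uniform time by the Picard–Lindelöf theorem.
[cite: TaylorPDEIII2011, Ch. 15, §7] -/
theorem quasilinear_shortTime_existence_zero [CompactSpace M] (h0 : Module.finrank ℝ E = 0)
    (b : Module.Basis ιb ℝ E) {𝒪 : Set (M × W)} (h𝒪 : IsOpen 𝒪) (P : (M → W) → M → W)
    (a : M → E × W × (E →L[ℝ] W) → ιb → ιb → ℝ) (f : M → E × W × (E →L[ℝ] W) → W)
    (hf : ∀ z, ContDiffOn ℝ ∞ (f z) {j | j.1 ∈ (extChartAt I z).target ∧ ((extChartAt I z).symm j.1, j.2.1) ∈ 𝒪})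
    (hP : ∀ u : M → W, ContMDiff I 𝓘(ℝ, W) ∞ u → (∀ x, (x, u x) ∈ 𝒪) → ∀ z, ∀ y ∈ (extChartAt I z).target,
      P u ((extChartAt I z).symm y) =
        (∑ i, ∑ i', a z (y, u ((extChartAt I z).symm y), fderiv ℝ (u ∘ (extChartAt I z).symm) y) i i' •
          fderiv ℝ (fderiv ℝ (u ∘ (extChartAt I z).symm)) y (b i) (b i')) +
        f z (y, u ((extChartAt I z).symm y), fderiv ℝ (u ∘ (extChartAt I z).symm) y))
    (u₀ : M → W) (hg₀ : ∀ x, (x, u₀ x) ∈ 𝒪) :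
    ∃ ε : ℝ, 0 < ε ∧ ∃ u : M → ℝ → W,
      ContMDiffOn (I.prod 𝓘(ℝ, ℝ)) 𝓘(ℝ, W) ∞ (fun p : M × ℝ ↦ u p.1 p.2) (univ ×ˢ Icc 0 ε) ∧
      (∀ x, u x 0 = u₀ x) ∧ (∀ t ∈ Icc (0 : ℝ) ε, ∀ x, (x, u x t) ∈ 𝒪) ∧
      ∀ t ∈ Icc (0 : ℝ) ε, ∀ x, HasDerivWithinAt (u x) (P (fun x' ↦ u x' t) x) (Icc 0 ε) t := by
  classical
  /- ## the manifold is finite and discrete -/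
  haveI hE : Subsingleton E := Module.finrank_zero_iff.1 h0
  haveI hH : Subsingleton H := I.injective.subsingleton
  have hopen : ∀ x : M, IsOpen ({x} : Set M) := by
    intro x
    have h1 : (chartAt H x).source = {x} :=
      Set.eq_singleton_iff_unique_mem.2 ⟨mem_chart_source H x, fun x' hx' ↦ (chartAt H x).injOn hx' (mem_chart_source H x) (Subsingleton.elim _ _)⟩
    rw [← h1]; exact (chartAt H x).open_source
  haveI : DiscreteTopology M := ⟨eq_bot_of_singletons_open hopen⟩
  haveI : Finite M := finite_of_compact_of_discrete
  haveI : IsEmpty ιb := by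
    have h := Module.finrank_eq_card_basis b
    rw [h0] at h
    exact Fintype.card_eq_zero_iff.1 h.symm
  have hclm : ∀ L : E →L[ℝ] W, L = 0 := fun L ↦ by ext v; rw [Subsingleton.elim v 0]; simp
  have hcm : ∀ u : M → W, ContMDiff I 𝓘(ℝ, W) ∞ u := fun u x ↦
    contMDiffAt_const.congr_of_eventuallyEq (by filter_upwards [(hopen x).mem_nhds rfl] with x' hx'; rw [hx'])
  /- ## the reduced right-hand side -/
  set g : M → W → W := fun z w ↦ f z (extChartAt I z z, w, 0) with hg
  have hPz : ∀ u : M → W, (∀ x, (x, u x) ∈ 𝒪) → ∀ z, P u z = g z (u z) := by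
    intro u hgu z
    have h := hP u (hcm u) hgu z (extChartAt I z z) (mem_extChartAt_target z)
    rw [extChartAt_to_inv] at h
    rw [h, hg, Finset.univ_eq_empty, Finset.sum_empty, zero_add, hclm (fderiv ℝ (u ∘ (extChartAt I z).symm) (extChartAt I z z))]
  set U : M → Set W := fun z ↦ {w | (z, w) ∈ 𝒪} with hU
  have hUo : ∀ z, IsOpen (U z) := fun z ↦ h𝒪.preimage (continuous_const.prodMk continuous_id)
  have hgs : ∀ z, ContDiffOn ℝ ∞ (g z) (U z) := by
    intro z
    have hσ : ContDiff ℝ ∞ fun w : W ↦ ((extChartAt I z z, w, (0 : E →L[ℝ] W)) : E × W × (E →L[ℝ] W)) :=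
      contDiff_const.prodMk (contDiff_id.prodMk contDiff_const)
    refine (hf z).comp hσ.contDiffOn fun w hw ↦ ⟨mem_extChartAt_target z, ?_⟩
    simp only [extChartAt_to_inv]; exact hw
  /- ## local solutions, point by point -/
  have hloc : ∀ z, ∃ α : ℝ → W, α 0 = u₀ z ∧ ∃ ε > (0 : ℝ), (∀ t ∈ Ioo (-ε) ε, HasDerivAt α (g z (α t)) t) ∧ ∀ t ∈ Ioo (-ε) ε, α t ∈ U z := by
    intro z
    have h1 : ContDiffAt ℝ 1 (g z) (u₀ z) := ((hgs z).of_le (by norm_cast)).contDiffAt ((hUo z).mem_nhds (hg₀ z))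
    obtain ⟨α, hα0, ε, hε, hαd⟩ := h1.exists_forall_mem_closedBall_exists_eq_forall_mem_Ioo_hasDerivAt₀ 0
    simp only [zero_sub, zero_add] at hαd
    -- staying in `U z` for small times
    have hc : ContinuousAt α 0 := (hαd 0 (by simp [hε])).continuousAt
    have hmem : ∀ᶠ t in 𝓝 (0 : ℝ), α t ∈ U z := hc.preimage_mem_nhds (by rw [hα0]; exact (hUo z).mem_nhds (hg₀ z))
    obtain ⟨δ, hδ, hδm⟩ := Metric.eventually_nhds_iff.1 hmem
    refine ⟨α, hα0, min ε δ, lt_min hε hδ, fun t ht ↦ hαd t ⟨lt_of_le_of_lt (neg_le_neg (min_le_left _ _)) ht.1, lt_of_lt_of_le ht.2 (min_le_left _ _)⟩,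
      fun t ht ↦ hδm ?_⟩
    rw [Real.dist_eq, sub_zero, abs_lt]
    exact ⟨lt_of_le_of_lt (neg_le_neg (min_le_right _ _)) ht.1, lt_of_lt_of_le ht.2 (min_le_right _ _)⟩
  choose α hα0 ε' hε' hαd hαU using hloc
  obtain ⟨ε₀, hε₀, hle⟩ : ∃ ε₀ : ℝ, 0 < ε₀ ∧ ∀ z, ε₀ ≤ ε' z := by
    by_cases hM : Nonempty M
    · obtain ⟨z₀, hz₀⟩ := Finite.exists_min ε'
      exact ⟨ε' z₀, hε' z₀, hz₀⟩
    · exact ⟨1, one_pos, fun z ↦ (hM ⟨z⟩).elim⟩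
  set ε : ℝ := ε₀ / 2 with hεd
  have hε : 0 < ε := by positivity
  have hIcc : ∀ z, ∀ t ∈ Icc (0 : ℝ) ε, t ∈ Ioo (-(ε' z)) (ε' z) := fun z t ht ↦
    ⟨by linarith [ht.1, hε' z], by linarith [ht.2, hle z]⟩
  /- ## the solution -/
  have hgraph : ∀ t ∈ Icc (0 : ℝ) ε, ∀ x, (x, α x t) ∈ 𝒪 := fun t ht x ↦ hαU x t (hIcc x t ht)
  have hode : ∀ t ∈ Icc (0 : ℝ) ε, ∀ x, HasDerivWithinAt (α x) (P (fun x' ↦ α x' t) x) (Icc 0 ε) t := by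
    intro t ht x
    rw [hPz (fun x' ↦ α x' t) (hgraph t ht) x]
    exact (hαd x t (hIcc x t ht)).hasDerivWithinAt
  have hsmooth : ∀ x, ContDiffOn ℝ ∞ (α x) (Icc 0 ε) := by
    intro x
    have hfield : ContDiffOn ℝ (⊤ : ℕ∞) (uncurry fun (_ : ℝ) (w : W) ↦ g x w) (Icc 0 ε ×ˢ U x) :=
      (hgs x).comp contDiffOn_snd fun q hq ↦ (mem_prod.1 hq).2
    exact ODE.contDiffOn_enat_Icc_of_hasDerivWithinAt hfield (fun t ht ↦ (hαd x t (hIcc x t ht)).hasDerivWithinAt) fun t ht ↦ hαU x t (hIcc x t ht)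
  refine ⟨ε, hε, α, ?_, hα0, hgraph, hode⟩
  rintro ⟨x, t⟩ hxt
  have ht : t ∈ Icc 0 ε := (mem_prod.1 hxt).2
  have h1 : ContMDiffOn 𝓘(ℝ, ℝ) 𝓘(ℝ, W) ∞ (α x) (Icc 0 ε) := contMDiffOn_iff_contDiffOn.2 (hsmooth x)
  have h2 : ContMDiffOn (I.prod 𝓘(ℝ, ℝ)) 𝓘(ℝ, W) ∞ (α x ∘ Prod.snd) (univ ×ˢ Icc 0 ε) :=
    h1.comp (contMDiffOn_snd (I := I) (J := 𝓘(ℝ, ℝ)) (M := M) (N := ℝ)) fun p hp ↦ (mem_prod.1 hp).2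
  refine (h2 _ hxt).congr_of_eventuallyEq ?_ rfl
  have hn : ({x} : Set M) ×ˢ (univ : Set ℝ) ∈ 𝓝[univ ×ˢ Icc 0 ε] ((x, t) : M × ℝ) :=
    mem_nhdsWithin_of_mem_nhds (((hopen x).prod isOpen_univ).mem_nhds (mk_mem_prod rfl (mem_univ _)))
  filter_upwards [hn] with p hp
  obtain ⟨hp1, -⟩ := mem_prod.1 hp
  rw [mem_singleton_iff] at hp1
  simp [hp1]

end Zero

/-! ### The statement `hQL` -/

/-- **Short-time existence for quasilinear strictly parabolic systems on a closed manifold**, in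
the exact form of hypothesis `hQL` of
`Literature.Geometry.Riemannian.ricciFlow_shortTime_existence_of_quasilinear`: for a second-order
operator `P` on maps `M → W` represented in every extended chart by a smooth symmetric positive
definite top-order coefficient and a smooth lower-order part on an open jet set `𝒪`, every smooth
initial map with graph in `𝒪` is the initial value of a solution `u`, jointly smooth on
`M × [0, ε]`, with graph in `𝒪`, of `∂ₜ u = P(u)` (derivatives within `[0, ε]`).
[cite: TaylorPDEIII2011, Ch. 15, §7] [cite: MantegazzaMartinazzi2012, Thm. 1.1] -/
theorem quasilinear_shortTime_existence {E : Type u} [NormedAddCommGroup E] [NormedSpace ℝ E] [FiniteDimensional ℝ E]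
    [CompleteSpace E] {H : Type v} [TopologicalSpace H] (I : ModelWithCorners ℝ E H)
    [I.Boundaryless] (M : Type w) [TopologicalSpace M] [T2Space M] [SecondCountableTopology M]
    [CompactSpace M] [ChartedSpace H M] [IsManifold I ∞ M]
    {W : Type u} [NormedAddCommGroup W] [NormedSpace ℝ W] [FiniteDimensional ℝ W]
    {ι : Type} [Fintype ι] [DecidableEq ι] (b : Module.Basis ι ℝ E)
    (𝒪 : Set (M × W)) (h𝒪 : IsOpen 𝒪) (P : (M → W) → M → W)
    (a : M → E × W × (E →L[ℝ] W) → ι → ι → ℝ) (f : M → E × W × (E →L[ℝ] W) → W)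
    (ha : ∀ z i i', ContDiffOn ℝ ∞ (fun j ↦ a z j i i')
      {j | j.1 ∈ (extChartAt I z).target ∧ ((extChartAt I z).symm j.1, j.2.1) ∈ 𝒪})
    (hf : ∀ z, ContDiffOn ℝ ∞ (f z)
      {j | j.1 ∈ (extChartAt I z).target ∧ ((extChartAt I z).symm j.1, j.2.1) ∈ 𝒪})
    (hstruct : ∀ z (j : E × W × (E →L[ℝ] W)), j.1 ∈ (extChartAt I z).target →
      ((extChartAt I z).symm j.1, j.2.1) ∈ 𝒪 →
        (∀ i i', a z j i i' = a z j i' i) ∧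
          ∀ ξ : ι → ℝ, ξ ≠ 0 → 0 < ∑ i, ∑ i', a z j i i' * ξ i * ξ i')
    (hP : ∀ u : M → W, ContMDiff I 𝓘(ℝ, W) ∞ u → (∀ x, (x, u x) ∈ 𝒪) →
      ∀ z, ∀ y ∈ (extChartAt I z).target,
        P u ((extChartAt I z).symm y) =
          (∑ i, ∑ i', a z (y, u ((extChartAt I z).symm y), fderiv ℝ (u ∘ (extChartAt I z).symm) y)
              i i' • fderiv ℝ (fderiv ℝ (u ∘ (extChartAt I z).symm)) y (b i) (b i')) +
            f z (y, u ((extChartAt I z).symm y), fderiv ℝ (u ∘ (extChartAt I z).symm) y))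
    (u₀ : M → W) (hu₀ : ContMDiff I 𝓘(ℝ, W) ∞ u₀) (hg₀ : ∀ x, (x, u₀ x) ∈ 𝒪) :
    ∃ ε : ℝ, 0 < ε ∧ ∃ u : M → ℝ → W,
      ContMDiffOn (I.prod 𝓘(ℝ, ℝ)) 𝓘(ℝ, W) ∞ (fun p : M × ℝ ↦ u p.1 p.2) (univ ×ˢ Icc 0 ε) ∧
      (∀ x, u x 0 = u₀ x) ∧ (∀ t ∈ Icc (0 : ℝ) ε, ∀ x, (x, u x t) ∈ 𝒪) ∧
      ∀ t ∈ Icc (0 : ℝ) ε, ∀ x,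
        HasDerivWithinAt (u x) (P (fun x' ↦ u x' t) x) (Icc 0 ε) t := by
  rcases Nat.eq_zero_or_pos (Module.finrank ℝ E) with h0 | hpos
  · exact quasilinear_shortTime_existence_zero (I := I) h0 b h𝒪 P a f hf hP u₀ hg₀
  · haveI : Nontrivial E := Module.finrank_pos_iff.1 hpos
    exact quasilinear_shortTime_existence_pos (I := I) b h𝒪 P a f ha hf hstruct hP u₀ hu₀ hg₀

end Literature.Analysis.PDE
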